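import Summits.BirchSwinnertonDyer.BirchSwinnertonDyer.Theorems.ManinLocalTwoThreeEtaMonomialsFiftySix
import Summits.BirchSwinnertonDyer.BirchSwinnertonDyer.Theorems.ManinLocalTwoThreeEtaLogDerivativeForms
import Literature.NumberTheory.ModularForms.EtaQuotientModularForms
import HarnessLib

/-!
# Level 14 (a ROOT for the twist families): the players of the weight-4 E₂ road on `X₀(14) = 14a1`

Cell bsd-f2-manin, route `ManinLocalTwoThree` (cruxes C2 `ManinOddAtFour` stmt-22967 / C3 `ManinPrimeToThreeAtNine` stmt-22968),
prover seat p3 gen 25.  `X₀(14)` has genus one and is the optimal curve `14a1 = [1, 0, 1, 4, −6]`; the level `14` is SEMISTABLE, so it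
is not in the domain of C2/C3 — it is a ROOT: once `|c| = 1` is known fact-free for every lattice-optimal `X₀(14)`-datum
(`LevelManinOne 14`, sequel file `…ManinConstantFourteen`), the tree's twist engines `twistLevelManinOne_of_levelManinOne` (odd `p`)
and `dyadicTwistLevelManinOne_of_levelManinOne` (`d ∈ {−1, ±2}`) give `2 ∤ c`, `3 ∤ c` on the ADDITIVE twist levels
`112 = 16·7` (`112c = 14a ⊗ χ₋₄`), `448`, `896`, `126 = 9·14`, `14p²`, … with no printed fact.

THE DEVICE (p3 g24's E₂ road in weight 4 — no `y`-coordinate needed).  On `14a1` the function `x − 1` is the single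
`η`-quotient `𝓔 = η₂η₇⁷/(η₁η₁₄⁷)` (double pole at the cusp `∞`, double zero at the cusp `1/7`, which is the rational
`2`-torsion point `(1, −1)`), and the newform is `φ₁₄ = η₁η₂η₇η₁₄` (tree `cuspFormEta14`).  Since
`(2y + x + 1)² = 4x³ + x² + 18x − 23 = 𝓔(4𝓔² + 13𝓔 + 32)` and `𝓔′ = (πi/12)·G·𝓔` with
`G = −E₂(τ) + 2E₂(2τ) + 49E₂(7τ) − 98E₂(14τ) ∈ M₂(Γ₀(14))` (`EtaLogDerivativeForms`), the differential equation
`(𝓔′)² = (2πiφ₁₄)²·𝓔(4𝓔² + 13𝓔 + 32)` is EQUIVALENT to the identity of holomorphic weight-4 forms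
**`G² = 2304·φ₁₄²𝓔 + 7488·φ₁₄² + 18432·φ₁₄²/𝓔` in `M₄(Γ₀(14))`** (all three `η`-quotients on the right are holomorphic at
the four cusps; Sturm bound `4·24/12 = 8`).  This file supplies the players and their `q`-remainders through `o(q⁹)`:

* §1 `𝓔` is `Γ₀(14)`-invariant; `A = φ₁₄²𝓔 = η₁η₂³η₇⁹/η₁₄⁵`, `F = φ₁₄² = η₁²η₂²η₇²η₁₄²`, `C = φ₁₄²/𝓔 = η₁³η₂η₁₄⁹/η₇⁵` are in
  `M₄(Γ₀(14))` (Newman + Ligozat by `decide`, tree `etaQuotientModularForm`); `G ∈ M₂(Γ₀(14))`;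
* §2 the four `η`-quotients as `q`-monomials times Euler functions `E_δ = ∏(1 − q^{δn})`;
* §3 `E₂(δτ)` (`δ ∣ 14`) and `E_7` through `o(q⁹)` (tree `tendsto_E2_sixMulPt`, pentagonal numbers; `E_1`, `E_2` through `o(q⁹)`
  are the tree's `EulerRemaindersForty.tendsto_eulerFn_one_nine`, `EulerRemaindersFortyEight.tendsto_eulerFn_two_nine`).

HONEST FRAMING: pure bookkeeping and `q`-series analysis; nothing here proves C2, C3, Manin's conjecture or BSD; items 22967/22968
stay OPEN.  No definition, no named fact, no sorry. [cite: Ligozat1975, Ch. 3] [cite: Zagier2008, §2.3]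
[cite: CremonaAlgorithms1997, §2.10 and Table 1 (14a1)]
-/

set_option autoImplicit false
-- lint-debt: the directory name repeats the summit name (sibling precedent `ManinLocalTwoThreeEtaMonomialsFiftySix.lean`)
set_option linter.dupNamespace false

noncomputable section

open Complex Filter Topology Set Asymptotics Polynomial EisensteinSeries
open UpperHalfPlane hiding I
open scoped Real Topology Manifold MatrixGroups ModularForm
open ModularForm CongruenceSubgroup
open Literature.NumberTheory.ModularForms
open Literature.NumberTheory.EllipticCurves Literature.NumberTheory.EllipticCurves.ModularForms

namespace Summit.BirchSwinnertonDyer.BirchSwinnertonDyer.Theorems.ManinLocalTwoThree.EtaQuotientsFourteen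

open QRemainder EulerRemainders EtaLogDerivativeForms
open EulerRemaindersSixtyFour (cexp_eq_qParam_pow)

/-! ## §1 The players: `𝓔`, `A`, `F`, `C`, `G` -/

/-- The divisors of `14`. [folklore] -/
theorem divisors_fourteen : Nat.divisors 14 = {1, 2, 7, 14} := by decide

/-- Newman's conditions for `𝓔 = η₂η₇⁷/(η₁η₁₄⁷)` (`= x − 1` on `14a1`) in weight `0` (`∏ δ^{|r_δ|} = 2⁸7¹⁴ = 13176688²`).
[cite: Ligozat1975, Ch. 3] -/
theorem newmanCond_E : NewmanCond 14 (expFn [(1, -1), (2, 1), (7, 7), (14, -7)]) 0 :=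
  ⟨by decide, by decide, by decide, ⟨13176688, by decide⟩⟩

/-- **`𝓔(γτ) = 𝓔(τ)` for `γ ∈ Γ₀(14)`.** [cite: Ligozat1975, Ch. 3] -/
theorem E_smul (γ : Gamma0 14) (τ : ℍ) :
    etaQuotient 14 (expFn [(1, -1), (2, 1), (7, 7), (14, -7)]) ((γ : SL(2, ℤ)) • τ)
      = etaQuotient 14 (expFn [(1, -1), (2, 1), (7, 7), (14, -7)]) τ := by
  simpa using etaQuotient_smul_of_mem_Gamma0 14 (by norm_num) (expFn [(1, -1), (2, 1), (7, 7), (14, -7)]) 0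
    Even.zero newmanCond_E γ.2 τ

/-- Newman's conditions for `A = φ₁₄²𝓔 = η₁η₂³η₇⁹/η₁₄⁵` in weight `4` (`∏ δ^{|r_δ|} = 13176688²`). [cite: Ligozat1975, Ch. 3] -/
theorem newmanCond_A : NewmanCond 14 (expFn [(1, 1), (2, 3), (7, 9), (14, -5)]) 4 :=
  ⟨by decide, by decide, by decide, ⟨13176688, by decide⟩⟩

/-- Ligozat's orders of `A` at the four cusps are `≥ 0` (`48, 96, 672, 0` in units of `1/24`). [cite: Ligozat1975, Ch. 3] -/
theorem cuspOrder24_nonneg_A :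
    ∀ t ∈ (14 : ℕ).divisors, 0 ≤ cuspOrder24 14 (expFn [(1, 1), (2, 3), (7, 9), (14, -5)]) t := by
  decide

/-- **`A ∈ M₄(Γ₀(14))`.** [cite: Ligozat1975, Ch. 3] -/
theorem exists_modularForm_A :
    ∃ F : ModularForm (Gamma0 14) 4, ⇑F = etaQuotient 14 (expFn [(1, 1), (2, 3), (7, 9), (14, -5)]) :=
  ⟨etaQuotientModularForm 14 _ 4 (by decide) newmanCond_A cuspOrder24_nonneg_A, rfl⟩

/-- Newman's conditions for `F = φ₁₄² = η₁²η₂²η₇²η₁₄²` in weight `4` (`∏ δ^{|r_δ|} = 196²`). [cite: Ligozat1975, Ch. 3] -/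
theorem newmanCond_F : NewmanCond 14 (expFn [(1, 2), (2, 2), (7, 2), (14, 2)]) 4 :=
  ⟨by decide, by decide, by decide, ⟨196, by decide⟩⟩

/-- Ligozat's orders of `F` at the four cusps are `≥ 0` (indeed `48` each). [cite: Ligozat1975, Ch. 3] -/
theorem cuspOrder24_nonneg_F :
    ∀ t ∈ (14 : ℕ).divisors, 0 ≤ cuspOrder24 14 (expFn [(1, 2), (2, 2), (7, 2), (14, 2)]) t := by
  decide

/-- **`F ∈ M₄(Γ₀(14))`.** [cite: Ligozat1975, Ch. 3] -/
theorem exists_modularForm_F :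
    ∃ F : ModularForm (Gamma0 14) 4, ⇑F = etaQuotient 14 (expFn [(1, 2), (2, 2), (7, 2), (14, 2)]) :=
  ⟨etaQuotientModularForm 14 _ 4 (by decide) newmanCond_F cuspOrder24_nonneg_F, rfl⟩

/-- Newman's conditions for `C = φ₁₄²/𝓔 = η₁³η₂η₁₄⁹/η₇⁵` in weight `4` (`∏ δ^{|r_δ|} = 2¹⁰7¹⁴ = 26353376²`). [cite: Ligozat1975, Ch. 3] -/
theorem newmanCond_C : NewmanCond 14 (expFn [(1, 3), (2, 1), (7, -5), (14, 9)]) 4 :=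
  ⟨by decide, by decide, by decide, ⟨26353376, by decide⟩⟩

/-- Ligozat's orders of `C` at the four cusps are `≥ 0` (`48, 96, 0, 1344`). [cite: Ligozat1975, Ch. 3] -/
theorem cuspOrder24_nonneg_C :
    ∀ t ∈ (14 : ℕ).divisors, 0 ≤ cuspOrder24 14 (expFn [(1, 3), (2, 1), (7, -5), (14, 9)]) t := by
  decide

/-- **`C ∈ M₄(Γ₀(14))`.** [cite: Ligozat1975, Ch. 3] -/
theorem exists_modularForm_C :
    ∃ F : ModularForm (Gamma0 14) 4, ⇑F = etaQuotient 14 (expFn [(1, 3), (2, 1), (7, -5), (14, 9)]) :=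
  ⟨etaQuotientModularForm 14 _ 4 (by decide) newmanCond_C cuspOrder24_nonneg_C, rfl⟩

/-- `Σ_{δ∣14} r_δ(𝓔) = 0` read in `ℂ`. [folklore] -/
theorem sum_expFn_E_cast :
    ∑ δ ∈ (14 : ℕ).divisors, ((expFn [(1, -1), (2, 1), (7, 7), (14, -7)] δ : ℤ) : ℂ) = 0 := by
  rw [← Int.cast_sum, show (∑ δ ∈ (14 : ℕ).divisors, expFn [(1, -1), (2, 1), (7, 7), (14, -7)] δ) = 0 by decide,
    Int.cast_zero]

/-- `G = Σ_δ r_δ(𝓔)·δ·E₂(δτ) = −E₂(τ) + 2E₂(2τ) + 49E₂(7τ) − 98E₂(14τ)` spelled out. [cite: Zagier2008, §2.3] -/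
theorem e2Comb_E_eq (τ : ℍ) :
    (∑ δ ∈ (14 : ℕ).divisors, ((expFn [(1, -1), (2, 1), (7, 7), (14, -7)] δ : ℤ) : ℂ) * (δ : ℂ) * E2 (sixMulPt δ τ))
      = -E2 (sixMulPt 1 τ) + 2 * E2 (sixMulPt 2 τ) + 49 * E2 (sixMulPt 7 τ) - 98 * E2 (sixMulPt 14 τ) := by
  rw [divisors_fourteen, Finset.sum_insert (by decide), Finset.sum_insert (by decide), Finset.sum_insert (by decide),
    Finset.sum_singleton]
  rw [show expFn [(1, -1), (2, 1), (7, 7), (14, -7)] 1 = (-1) by decide,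
    show expFn [(1, -1), (2, 1), (7, 7), (14, -7)] 2 = 1 by decide,
    show expFn [(1, -1), (2, 1), (7, 7), (14, -7)] 7 = 7 by decide,
    show expFn [(1, -1), (2, 1), (7, 7), (14, -7)] 14 = (-7) by decide]
  push_cast
  ring

/-- **`G = −E₂(τ) + 2E₂(2τ) + 49E₂(7τ) − 98E₂(14τ) ∈ M₂(Γ₀(14))`** (`Σ r_δ = 0`). [cite: DiamondShurman2005, §1.2] -/
theorem exists_modularForm_G : ∃ G : ModularForm (Gamma0 14) 2, ∀ τ : ℍ,
    G τ = -E2 (sixMulPt 1 τ) + 2 * E2 (sixMulPt 2 τ) + 49 * E2 (sixMulPt 7 τ) - 98 * E2 (sixMulPt 14 τ) := by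
  obtain ⟨G, hG⟩ := exists_modularForm_e2Comb 14 (fun δ ↦ ((expFn [(1, -1), (2, 1), (7, 7), (14, -7)] δ : ℤ) : ℂ))
    sum_expFn_E_cast
  exact ⟨G, fun τ ↦ (hG τ).trans (e2Comb_E_eq τ)⟩

/-- **`𝓔′ = (πi/12)·G·𝓔` on `ℍ`.** [cite: Zagier2008, §2.3] -/
theorem deriv_E (τ : ℍ) :
    deriv (etaQuotient 14 (expFn [(1, -1), (2, 1), (7, 7), (14, -7)]) ∘ ofComplex) τ
      = (π * I / 12) * (-E2 (sixMulPt 1 τ) + 2 * E2 (sixMulPt 2 τ) + 49 * E2 (sixMulPt 7 τ) - 98 * E2 (sixMulPt 14 τ))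
        * etaQuotient 14 (expFn [(1, -1), (2, 1), (7, 7), (14, -7)]) τ := by
  rw [deriv_etaQuotient_eq_e2Comb 14 _ τ, e2Comb_E_eq τ]

/-! ## §2 The `η`-quotients as `q`-monomials times Euler functions -/

/-- **`𝓔 = η₂η₇⁷/(η₁η₁₄⁷) = E₂E₇⁷/(q²E₁E₁₄⁷)`.** [folklore] -/
theorem E_eq (τ : ℍ) :
    etaQuotient 14 (expFn [(1, -1), (2, 1), (7, 7), (14, -7)]) τ
      = eulerFn 2 τ * eulerFn 7 τ ^ 7 / (Function.Periodic.qParam 1 (τ : ℂ) ^ 2 * eulerFn 1 τ * eulerFn 14 τ ^ 7) := by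
  have hE1 := eulerFn_ne_zero (by norm_num : 0 < 1) τ
  have hE14 := eulerFn_ne_zero (by norm_num : 0 < 14) τ
  have hq := qParam_ne_zero τ
  rw [etaQuotient_eq_cexp_mul_prod, divisors_fourteen]
  have hsum : (∑ δ ∈ ({1, 2, 7, 14} : Finset ℕ),
      (δ : ℤ) * expFn [(1, -1), (2, 1), (7, 7), (14, -7)] δ) = (-(24 * 2 : ℕ) : ℤ) := by decide
  rw [hsum, cexp_neg_eq_inv_qParam_pow]
  rw [Finset.prod_insert (by decide), Finset.prod_insert (by decide), Finset.prod_insert (by decide),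
    Finset.prod_singleton]
  rw [show expFn [(1, -1), (2, 1), (7, 7), (14, -7)] 1 = (-1) by decide,
    show expFn [(1, -1), (2, 1), (7, 7), (14, -7)] 2 = 1 by decide,
    show expFn [(1, -1), (2, 1), (7, 7), (14, -7)] 7 = 7 by decide,
    show expFn [(1, -1), (2, 1), (7, 7), (14, -7)] 14 = (-7) by decide]
  simp only [zpow_neg, zpow_ofNat]
  field_simp

/-- **`A = η₁η₂³η₇⁹/η₁₄⁵ = E₁E₂³E₇⁹/E₁₄⁵`** (no `q`-power: `Σ δ r_δ = 0`). [folklore] -/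
theorem A_eq (τ : ℍ) :
    etaQuotient 14 (expFn [(1, 1), (2, 3), (7, 9), (14, -5)]) τ
      = eulerFn 1 τ * eulerFn 2 τ ^ 3 * eulerFn 7 τ ^ 9 / eulerFn 14 τ ^ 5 := by
  have hE14 := eulerFn_ne_zero (by norm_num : 0 < 14) τ
  rw [etaQuotient_eq_cexp_mul_prod, divisors_fourteen]
  have hsum : (∑ δ ∈ ({1, 2, 7, 14} : Finset ℕ),
      (δ : ℤ) * expFn [(1, 1), (2, 3), (7, 9), (14, -5)] δ) = ((24 * 0 : ℕ) : ℤ) := by decide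
  rw [hsum, cexp_eq_qParam_pow, pow_zero, one_mul]
  rw [Finset.prod_insert (by decide), Finset.prod_insert (by decide), Finset.prod_insert (by decide),
    Finset.prod_singleton]
  rw [show expFn [(1, 1), (2, 3), (7, 9), (14, -5)] 1 = 1 by decide,
    show expFn [(1, 1), (2, 3), (7, 9), (14, -5)] 2 = 3 by decide,
    show expFn [(1, 1), (2, 3), (7, 9), (14, -5)] 7 = 9 by decide,
    show expFn [(1, 1), (2, 3), (7, 9), (14, -5)] 14 = (-5) by decide]
  simp only [zpow_neg, zpow_ofNat]
  field_simp

/-- **`F = φ₁₄² = η₁²η₂²η₇²η₁₄² = q²E₁²E₂²E₇²E₁₄²`.** [folklore] -/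
theorem F_eq (τ : ℍ) :
    etaQuotient 14 (expFn [(1, 2), (2, 2), (7, 2), (14, 2)]) τ
      = Function.Periodic.qParam 1 (τ : ℂ) ^ 2 * eulerFn 1 τ ^ 2 * eulerFn 2 τ ^ 2 * eulerFn 7 τ ^ 2 * eulerFn 14 τ ^ 2 := by
  rw [etaQuotient_eq_cexp_mul_prod, divisors_fourteen]
  have hsum : (∑ δ ∈ ({1, 2, 7, 14} : Finset ℕ),
      (δ : ℤ) * expFn [(1, 2), (2, 2), (7, 2), (14, 2)] δ) = ((24 * 2 : ℕ) : ℤ) := by decide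
  rw [hsum, cexp_eq_qParam_pow]
  rw [Finset.prod_insert (by decide), Finset.prod_insert (by decide), Finset.prod_insert (by decide),
    Finset.prod_singleton]
  rw [show expFn [(1, 2), (2, 2), (7, 2), (14, 2)] 1 = 2 by decide,
    show expFn [(1, 2), (2, 2), (7, 2), (14, 2)] 2 = 2 by decide,
    show expFn [(1, 2), (2, 2), (7, 2), (14, 2)] 7 = 2 by decide,
    show expFn [(1, 2), (2, 2), (7, 2), (14, 2)] 14 = 2 by decide]
  simp only [zpow_ofNat]
  ring

/-- **`C = η₁³η₂η₁₄⁹/η₇⁵ = q⁴E₁³E₂E₁₄⁹/E₇⁵`.** [folklore] -/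
theorem C_eq (τ : ℍ) :
    etaQuotient 14 (expFn [(1, 3), (2, 1), (7, -5), (14, 9)]) τ
      = Function.Periodic.qParam 1 (τ : ℂ) ^ 4 * eulerFn 1 τ ^ 3 * eulerFn 2 τ * eulerFn 14 τ ^ 9 / eulerFn 7 τ ^ 5 := by
  have hE7 := eulerFn_ne_zero (by norm_num : 0 < 7) τ
  rw [etaQuotient_eq_cexp_mul_prod, divisors_fourteen]
  have hsum : (∑ δ ∈ ({1, 2, 7, 14} : Finset ℕ),
      (δ : ℤ) * expFn [(1, 3), (2, 1), (7, -5), (14, 9)] δ) = ((24 * 4 : ℕ) : ℤ) := by decide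
  rw [hsum, cexp_eq_qParam_pow]
  rw [Finset.prod_insert (by decide), Finset.prod_insert (by decide), Finset.prod_insert (by decide),
    Finset.prod_singleton]
  rw [show expFn [(1, 3), (2, 1), (7, -5), (14, 9)] 1 = 3 by decide,
    show expFn [(1, 3), (2, 1), (7, -5), (14, 9)] 2 = 1 by decide,
    show expFn [(1, 3), (2, 1), (7, -5), (14, 9)] 7 = (-5) by decide,
    show expFn [(1, 3), (2, 1), (7, -5), (14, 9)] 14 = 9 by decide]
  simp only [zpow_neg, zpow_ofNat]
  field_simp

/-! ## §3 `E₂(δτ)` (`δ ∣ 14`), `E_7` through `o(q⁹)` -/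

/-- `σ₁(n)` for `1 ≤ n ≤ 9`. [folklore] -/
theorem sigma_one_le_nine :
    ArithmeticFunction.sigma 1 1 = 1 ∧ ArithmeticFunction.sigma 1 2 = 3 ∧ ArithmeticFunction.sigma 1 3 = 4 ∧
    ArithmeticFunction.sigma 1 4 = 7 ∧ ArithmeticFunction.sigma 1 5 = 6 ∧ ArithmeticFunction.sigma 1 6 = 12 ∧
    ArithmeticFunction.sigma 1 7 = 8 ∧ ArithmeticFunction.sigma 1 8 = 15 ∧ ArithmeticFunction.sigma 1 9 = 13 := by
  refine ⟨by decide, by decide, by decide, by decide, by decide, by decide, by decide, by decide, by decide⟩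

/-- **`E₂(τ) = 1 − 24q − 72q² − 96q³ − 168q⁴ − 144q⁵ − 288q⁶ − 192q⁷ − 360q⁸ − 312q⁹ + o(q⁹)`.** [cite: Zagier2008, §2.3] -/
theorem tendsto_E2_one_nine :
    Tendsto (fun τ : ℍ ↦ (E2 (sixMulPt 1 τ) - (1 - 24 * X - 72 * X ^ 2 - 96 * X ^ 3 - 168 * X ^ 4 - 144 * X ^ 5 - 288 * X ^ 6
      - 192 * X ^ 7 - 360 * X ^ 8 - 312 * X ^ 9 : ℂ[X]).eval (Function.Periodic.qParam 1 (τ : ℂ)))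
      / Function.Periodic.qParam 1 (τ : ℂ) ^ 9) atImInfty (𝓝 0) := by
  refine congr_poly ?_ (tendsto_E2_sixMulPt (by norm_num : 0 < 1) 9)
  obtain ⟨s1, s2, s3, s4, s5, s6, s7, s8, s9⟩ := sigma_one_le_nine
  simp only [Finset.sum_range_succ, Finset.sum_range_zero, e2NatMulCoeff_eq _ _ (by norm_num : 0 < 1)]
  norm_num [s1, s2, s3, s4, s5, s6, s7, s8, s9]
  simp only [map_ofNat]
  ring

/-- **`E₂(2τ) = 1 − 24q² − 72q⁴ − 96q⁶ − 168q⁸ + o(q⁹)`.** [cite: Zagier2008, §2.3] -/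
theorem tendsto_E2_two_nine :
    Tendsto (fun τ : ℍ ↦ (E2 (sixMulPt 2 τ) - (1 - 24 * X ^ 2 - 72 * X ^ 4 - 96 * X ^ 6 - 168 * X ^ 8 : ℂ[X]).eval
      (Function.Periodic.qParam 1 (τ : ℂ))) / Function.Periodic.qParam 1 (τ : ℂ) ^ 9) atImInfty (𝓝 0) := by
  refine congr_poly ?_ (tendsto_E2_sixMulPt (by norm_num : 0 < 2) 9)
  obtain ⟨s1, s2, s3, s4, s5, s6, s7, s8, s9⟩ := sigma_one_le_nine
  simp only [Finset.sum_range_succ, Finset.sum_range_zero, e2NatMulCoeff_eq _ _ (by norm_num : 0 < 2)]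
  norm_num [s1, s2, s3, s4, s5, s6, s7, s8, s9]
  simp only [map_ofNat]
  ring

/-- **`E₂(7τ) = 1 − 24q⁷ + o(q⁹)`.** [cite: Zagier2008, §2.3] -/
theorem tendsto_E2_seven_nine :
    Tendsto (fun τ : ℍ ↦ (E2 (sixMulPt 7 τ) - (1 - 24 * X ^ 7 : ℂ[X]).eval (Function.Periodic.qParam 1 (τ : ℂ)))
      / Function.Periodic.qParam 1 (τ : ℂ) ^ 9) atImInfty (𝓝 0) := by
  refine congr_poly ?_ (tendsto_E2_sixMulPt (by norm_num : 0 < 7) 9)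
  obtain ⟨s1, s2, s3, s4, s5, s6, s7, s8, s9⟩ := sigma_one_le_nine
  simp only [Finset.sum_range_succ, Finset.sum_range_zero, e2NatMulCoeff_eq _ _ (by norm_num : 0 < 7)]
  norm_num [s1, s2, s3, s4, s5, s6, s7, s8, s9]
  simp only [map_ofNat]
  ring

/-- **`E₂(14τ) = 1 + o(q⁹)`.** [cite: Zagier2008, §2.3] -/
theorem tendsto_E2_fourteen_nine :
    Tendsto (fun τ : ℍ ↦ (E2 (sixMulPt 14 τ) - (1 : ℂ[X]).eval (Function.Periodic.qParam 1 (τ : ℂ)))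
      / Function.Periodic.qParam 1 (τ : ℂ) ^ 9) atImInfty (𝓝 0) := by
  refine congr_poly ?_ (tendsto_E2_sixMulPt (by norm_num : 0 < 14) 9)
  simp only [Finset.sum_range_succ, Finset.sum_range_zero, e2NatMulCoeff_eq _ _ (by norm_num : 0 < 14)]
  norm_num

/-- The `q`-coefficients `0, …, 9` of `E_7 = ∏(1 − q^{7n})`: `1` at `0`, `−1` at `7`, else `0`. [folklore] -/
theorem coeff_formalEulerScaled_seven_le_nine (n : ℕ) (hn : n ≤ 9) :
    PowerSeries.coeff n (formalEulerScaled 7) = if n = 0 then 1 else if n = 7 then -1 else 0 := by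
  have h0 := EulerRemaindersTwenty.coeff_formalEulerPow_one_le_six 0 (by norm_num)
  have h1 := EulerRemaindersTwenty.coeff_formalEulerPow_one_le_six 1 (by norm_num)
  simp only at h0 h1
  interval_cases n <;> simp +decide [coeff_formalEulerScaled, h0, h1]

/-- **`E_7 = 1 − q⁷ + o(q⁹)`.** [folklore] -/
theorem tendsto_eulerFn_seven_nine :
    Tendsto (fun τ : ℍ ↦ (eulerFn 7 τ - (1 - X ^ 7 : ℂ[X]).eval (Function.Periodic.qParam 1 (τ : ℂ)))
      / Function.Periodic.qParam 1 (τ : ℂ) ^ 9) atImInfty (𝓝 0) := by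
  refine congr_poly ?_ (tendsto_of_hasSum (periodic_eulerFn 7) (mdifferentiable_eulerFn 7)
    (isBoundedAtImInfty_eulerFn (by norm_num)) (hasSum_eulerFn (by norm_num)) 9)
  have h := coeff_formalEulerScaled_seven_le_nine
  simp only [Finset.sum_range_succ, Finset.sum_range_zero, h 0 (by norm_num), h 1 (by norm_num),
    h 2 (by norm_num), h 3 (by norm_num), h 4 (by norm_num), h 5 (by norm_num), h 6 (by norm_num),
    h 7 (by norm_num), h 8 (by norm_num), h 9 (by norm_num)]
  norm_num
  ring

end Summit.BirchSwinnertonDyer.BirchSwinnertonDyer.Theorems.ManinLocalTwoThree.EtaQuotientsFourteen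

end
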